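import Literature.NumberTheory.Transcendental.KZLogCalculusProofs
import Literature.NumberTheory.Transcendental.KZDominatedFamilyRelations
import Literature.NumberTheory.Transcendental.KZSemialgebraicComplex
import Literature.NumberTheory.Transcendental.EllIterRep

/-!
# `NormalFormPrinciple` (stmt-KontsevichZagierPeriods-3869), line `SketchIdeator1` —
# stub `slabA_sub_pt_mem_relations`: Newton–Leibniz over the point, algebraic ends

Pure proof file (`--supports` the crux stmt-KontsevichZagierPeriods-3869; siege attempt k5,
variation "Mathlib API route"). The registered sub-goal `slabA_sub_pt_mem_relations` of the
algebraic-pole layer of the leaf `stub_boxRigidity` (dimension one): for real ALGEBRAIC ends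
`α ≤ β`, an interval representation `N = [(α,β), f]` of the Kontsevich–Zagier calculus and a
primitive `F` of `f` on `(α,β)` which is continuous on `[α,β]` and `ℚ`-semialgebraic there (read on
the first coordinate), the difference `[N] − [pt, F(β) − F(α)]` is a relation for every point
representation over `ℝ⁰` with that constant.

Proof. One Newton–Leibniz generator (rule (3) of [Kontsevich–Zagier 2001, §1.2]) over the base
`ℝ⁰` relates the CLOSED slab `R = [[α,β], f]` to the point: the fibre ends are the constants
`α`, `β` (real algebraic, hence `ℚ`-semialgebraic functions, `isSemialgebraicFunOn_const_of_isAlgebraic`),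
the primitive is `z ↦ F(z₀)`. The closed slab is `ℚ`-semialgebraic (complements of two open
half-spaces with algebraic offsets, `KZ.isSemialgebraic_setOf_apply_lt_const` /
`KZ.isSemialgebraic_setOf_const_lt_apply`), and it differs from the open slab `N.domain` by two
coordinate hyperplanes, which are Lebesgue-null (`Measure.pi_hyperplane`); so `f` is integrable on
it (`IntegrableOn.congr_set_ae`), `[R] ≡ [R|_{N.domain}]` (`IntegralRep.of_sub_of_restrict_mem_relations`,
rule (1)) and `[R|_{N.domain}] ≡ [N]` (congruence, `KZ.of_sub_of_mem_relations_of_eqOn`).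

## References

* M. Kontsevich, D. Zagier, *Periods* (2001), §1.2, rules (1) and (3).
* J. Bochnak, M. Coste, M.-F. Roy, *Real Algebraic Geometry* (1998), §2.1–2.2.
-/

noncomputable section

open MeasureTheory Set
open Literature.NumberTheory.Transcendental Literature.NumberTheory.Transcendental.KZ
open Literature.ModelTheory.ExponentialFields (IsSemialgebraic isSemialgebraic_univ)

namespace Summit.KontsevichZagierPeriods.Theorems.HurwitzMicroSectorsNormalFormPrincipleSlabAPointK5

/-- The closed coordinate slab `{x | a ≤ x i ≤ b} ⊂ ℝⁿ` with real algebraic ends is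
`ℚ`-semialgebraic: it is the intersection of the complements of the open half-spaces `{x i < a}`
and `{b < x i}`. [cite: BochnakCosteRoy1998, §2.1] -/
theorem isSemialgebraic_setOf_apply_mem_Icc_of_isAlgebraic {n : ℕ} {a b : ℝ} (ha : IsAlgebraic ℚ a)
    (hb : IsAlgebraic ℚ b) (i : Fin n) : IsSemialgebraic ℚ {x : Fin n → ℝ | x i ∈ Set.Icc a b} := by
  have h : {x : Fin n → ℝ | x i ∈ Set.Icc a b} =
      {x : Fin n → ℝ | x i < a}ᶜ ∩ {x : Fin n → ℝ | b < x i}ᶜ := by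
    ext x
    simp only [mem_setOf_eq, mem_Icc, mem_inter_iff, mem_compl_iff, not_lt]
  rw [h]
  exact (isSemialgebraic_setOf_apply_lt_const ha i).compl.inter
    (isSemialgebraic_setOf_const_lt_apply hb i).compl

/-- The two ends of a coordinate slab are Lebesgue-null: `{x | x i ∈ [a,b]} ∖ {x | x i ∈ (a,b)}`
lies in the union of the coordinate hyperplanes `{x i = a}` and `{x i = b}` of `ℝⁿ`, each of
measure zero (`Measure.pi_hyperplane`). [folklore] -/
theorem volume_setOf_apply_mem_Icc_diff_Ioo {n : ℕ} (a b : ℝ) (i : Fin n) :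
    volume ({x : Fin n → ℝ | x i ∈ Set.Icc a b} \ {x | x i ∈ Set.Ioo a b}) = 0 := by
  have ha : volume {x : Fin n → ℝ | x i = a} = 0 := by
    rw [volume_pi]
    exact Measure.pi_hyperplane _ _ _
  have hb : volume {x : Fin n → ℝ | x i = b} = 0 := by
    rw [volume_pi]
    exact Measure.pi_hyperplane _ _ _
  refine measure_mono_null (fun x hx => ?_) (measure_union_null ha hb)
  simp only [mem_sdiff, mem_setOf_eq, mem_Icc, mem_Ioo, not_and, not_lt] at hx
  simp only [mem_union, mem_setOf_eq]
  obtain ⟨⟨h1, h2⟩, h3⟩ := hx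
  rcases h1.lt_or_eq with h1 | h1
  · exact Or.inr (le_antisymm h2 (h3 h1))
  · exact Or.inl h1.symm

/-- **Newton–Leibniz over the point, algebraic ends** (rule (3), plus the null endpoints, rule (1)).
Let `α ≤ β` be real algebraic, `N = [(α,β), f]` an interval representation whose integrand
`x ↦ f(x₀)` is `ℚ`-semialgebraic on the closed slab, and `F` a primitive of `f` on `(α,β)`,
continuous on `[α,β]` and `ℚ`-semialgebraic there. Then `[N] − [pt, F(β) − F(α)] ∈ relations` for
every point representation `Z` over `ℝ⁰` with that constant.
[cite: KontsevichZagier2001, §1.2 rule (3)] -/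
theorem slabA_sub_pt_mem_relations {α β : ℝ} (hα : IsAlgebraic ℚ α) (hβ : IsAlgebraic ℚ β)
    (hαβ : α ≤ β) (f F : ℝ → ℝ)
    (hF : IsSemialgebraicFunOn ℚ {x : Fin 1 → ℝ | x 0 ∈ Set.Icc α β} (fun x => F (x 0)))
    (hFc : ContinuousOn F (Set.Icc α β))
    (hderiv : ∀ t ∈ Set.Ioo α β, HasDerivAt F (f t) t)
    (hf : IsSemialgebraicFunOn ℚ {x : Fin 1 → ℝ | x 0 ∈ Set.Icc α β} (fun x => f (x 0)))
    (N : IntegralRep 1) (hNd : N.domain = {x | x 0 ∈ Set.Ioo α β})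
    (hNi : EqOn N.integrand (fun x => f (x 0)) N.domain)
    (Z : IntegralRep 0) (hZd : Z.domain = univ) (hZi : Z.integrand = fun _ => F β - F α) :
    of N - of Z ∈ relations := by
  set C : Set (Fin 1 → ℝ) := {x | x 0 ∈ Set.Icc α β} with hC
  have hCsa : IsSemialgebraic ℚ C := isSemialgebraic_setOf_apply_mem_Icc_of_isAlgebraic hα hβ 0
  -- the open slab `N.domain` sits inside the closed slab `C`, with null complement
  have hsub : N.domain ⊆ C := by
    rw [hNd]
    exact fun x hx => Set.Ioo_subset_Icc_self hx
  have hnull : volume (C \ N.domain) = 0 := by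
    rw [hNd]
    exact volume_setOf_apply_mem_Icc_diff_Ioo α β 0
  have hae : C =ᵐ[volume] N.domain := by
    refine ae_eq_set.2 ⟨hnull, ?_⟩
    rw [Set.sdiff_eq_empty.2 hsub, measure_empty]
  -- the integrand `f` on the closed slab is integrable (it is `N.integrand` a.e.)
  have hfi : IntegrableOn (fun x : Fin 1 → ℝ => f (x 0)) C :=
    (N.integrableOn.congr_fun hNi
      (IsSemialgebraic.measurableSet_holds N.isSemialgebraic_domain)).congr_set_ae hae
  -- the closed-slab representation `R = [[α,β], f]`
  obtain ⟨R, hRd, hRi⟩ : ∃ R : IntegralRep 1, R.domain = C ∧ R.integrand = fun x => f (x 0) :=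
    ⟨⟨C, fun x => f (x 0), hCsa, hf, hfi⟩, rfl, rfl⟩
  have hs0 : ∀ (x : Fin 0 → ℝ) (t : ℝ), (Fin.snoc x t : Fin 1 → ℝ) 0 = t := fun _ _ => rfl
  -- (i) ONE Newton–Leibniz move over `ℝ⁰`: `[R] − [Z] ∈ newtonLeibnizRel`, primitive `F (z 0)`
  have hNL : of R - of Z ∈ newtonLeibnizRel := by
    refine ⟨0, R, Z, fun _ => α, fun _ => β, fun z => F (z 0), ?_, ?_, ?_,
      fun _ _ => hαβ, ?_, ?_, ?_, ?_, rfl⟩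
    · rw [hRd]
      exact hF
    · rw [hZd]
      exact isSemialgebraicFunOn_const_of_isAlgebraic isSemialgebraic_univ hα
    · rw [hZd]
      exact isSemialgebraicFunOn_const_of_isAlgebraic isSemialgebraic_univ hβ
    · rw [hRd, hZd, hC]
      ext z
      simp only [Set.mem_setOf_eq, Set.mem_Icc, Set.mem_univ, true_and]
      rfl
    · -- continuity of `t ↦ F t` on the closed fibre
      intro x _
      simp only [hs0]
      exact hFc
    · -- derivative on the open fibre
      intro x _ t ht
      rw [hRi]
      simp only [hs0]
      exact hderiv t ht
    · intro x _
      rw [hZi]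
      simp only [hs0]
  -- (ii) closed slab versus the open slab `N.domain` (null endpoints), and congruence with `N`
  have hsubR : N.domain ⊆ R.domain := by
    rw [hRd]
    exact hsub
  have h2 : of R - of (R.restrict N.domain N.isSemialgebraic_domain hsubR) ∈ relations :=
    R.of_sub_of_restrict_mem_relations N.isSemialgebraic_domain hsubR (by rw [hRd]; exact hnull)
  have h3 : of (R.restrict N.domain N.isSemialgebraic_domain hsubR) - of N ∈ relations :=
    of_sub_of_mem_relations_of_eqOn rfl fun x hx => by
      rw [IntegralRep.integrand_restrict, hRi, hNi hx]
  have h4 : of R - of N ∈ relations := by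
    have := relations.add_mem h2 h3
    rwa [sub_add_sub_cancel] at this
  have h5 := relations.sub_mem (newtonLeibnizRel_subset_relations hNL) h4
  rwa [sub_sub_sub_cancel_left] at h5

end Summit.KontsevichZagierPeriods.Theorems.HurwitzMicroSectorsNormalFormPrincipleSlabAPointK5
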